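import Mathlib
import Literature.MathematicalPhysics.QuantumLattice.FermiRG.Salmhofer1998Sec5PropagatorLemmas
import HarnessLib

/-!
# Salmhofer 1998, Lemma 5 — toolkit IV: the `p₀`-integral through the step function `ω_β` ((5.14)),
# summation by parts, and Matsubara counting

M. Salmhofer, *Continuous renormalization for fermions and Fermi liquid theory*, Commun. Math. Phys.
**194** (1998) 249–295 = arXiv:cond-mat/9706188 [Salmhofer1998], §5.4–5.5 (render
`paper:arxiv-cond-mat_9706188` p.19 L86–105, p.20 L84–98; locators `p.N Ln` = chunk `pNNNN.txt` line `n`).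

Theorem-only companion of the FROZEN statement file `Salmhofer1998Sec5.lean` (licence F-086
`DotCovarianceL1Bound`; no definition, no named fact, net debt `0`):

* **(5.14) for finitely supported integrands**: `∫_ℝ dp₀ f(ω_β(p₀)) = (2π/β) Σ_n f(ω_n)` when `f(ω_n) = 0`
  off a finite set of `n` (`integral_comp_omegaStep_eq_sum`) — the form in which (5.23) is a finite
  Matsubara sum (the printed (5.14) is stated "for any continuous and integrable function").
* **Summation by parts** ("since the `k₀`-dependence is via the step function `ω_β`, one has to use
  summation by parts", (5.25′), p.20 L92–98): `(1 - e^{iax₀})² Σ_n e^{ix₀ω_n} c_n =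
  Σ_n e^{ix₀ω_n} (c_n - 2c_{n-1} + c_{n-2})` for finitely supported `c` (`sq_one_sub_mul_sum_eq`), with
  `ω_{n+1} = ω_n + 2π/β` (`matsFreq_succ`) and `ω_n - j(2π/β) = ω_{n-j}`.
* `|1 - e^{iθ}| ≥ (2/π)|θ|` for `|θ| ≤ π` (`two_div_pi_mul_abs_le_norm_one_sub_exp`; print: `|1 - e^{2πix₀/β}|
  ≥ (4/β) min{|x₀|, β/2 - |x₀|}`, p.20 L100–103 — on `|x₀| ≤ β/2` the present bound `4|x₀|/β` is at
  least as strong).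
* **Matsubara counting**: the set `{n : |ω_n| ≤ ε}` is finite with at most `2βε/π` elements
  (`exists_matsubara_support`; cf. `M_β ≤ (2/π)ε_t`, (5.19′) p.20 L19–22), and its three shifts have at
  most thrice as many (`card_union_shifts_le`).

No `instance`, no `notation`, no sorry/axiom; nothing about the Hubbard model is asserted or denied.
-/

noncomputable section

open Filter Function MeasureTheory Set
open scoped Topology

namespace Literature.MathematicalPhysics.QuantumLattice.FermiRG

namespace Salmhofer1998

/-! ### (5.14) for finitely supported integrands -/

/-- `p₀ ∈ (2πn/β, 2π(n+1)/β]` iff `⌈βp₀/(2π)⌉ - 1 = n` (the index of the step function (5.13)).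
[cite: Salmhofer1998, §5.4 (5.13) (p.19 L93–98)] -/
theorem mem_Ioc_iff_ceil_eq {β : ℝ} (hβ : 0 < β) (p₀ : ℝ) (n : ℤ) :
    p₀ ∈ Set.Ioc (2 * Real.pi * n / β) (2 * Real.pi * (n + 1) / β) ↔
      ⌈β * p₀ / (2 * Real.pi)⌉ - 1 = n := by
  have hπ : 0 < 2 * Real.pi := by positivity
  rw [Set.mem_Ioc, sub_eq_iff_eq_add, Int.ceil_eq_iff]
  push_cast
  rw [div_lt_iff₀ hβ, le_div_iff₀ hβ, add_sub_cancel_right, lt_div_iff₀ hπ, div_le_iff₀ hπ]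
  constructor
  · rintro ⟨h1, h2⟩; constructor <;> linarith
  · rintro ⟨h1, h2⟩; constructor <;> linarith

/-- **(5.14), finitely supported version**: if `f(ω_n) = 0` for all `n` outside a finite set `S`, then
`∫_ℝ dp₀ f(ω_β(p₀)) = (2π/β) Σ_{n ∈ S} f(ω_n)` (`ω_β` is constant `= ω_n` on each interval
`(2πn/β, 2π(n+1)/β]`, of length `2π/β`). [cite: Salmhofer1998, §5.4 (5.14) (p.19 L100–105)] -/
theorem integral_comp_omegaStep_eq_sum {β : ℝ} (hβ : 0 < β) {f : ℝ → ℂ} (S : Finset ℤ)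
    (hf : ∀ n : ℤ, n ∉ S → f (matsFreq β n) = 0) :
    ∫ p₀ : ℝ, f (omegaStep β p₀) = ((2 * Real.pi / β : ℝ) : ℂ) * ∑ n ∈ S, f (matsFreq β n) := by
  set I : ℤ → Set ℝ := fun n => Set.Ioc (2 * Real.pi * n / β) (2 * Real.pi * (n + 1) / β) with hI
  -- pointwise: `f ∘ ω_β` is a finite sum of indicator functions
  have hpt : (fun p₀ : ℝ => f (omegaStep β p₀)) =
      fun p₀ => ∑ n ∈ S, (I n).indicator (fun _ => f (matsFreq β n)) p₀ := by
    funext p₀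
    set m : ℤ := ⌈β * p₀ / (2 * Real.pi)⌉ - 1 with hm
    have hω : omegaStep β p₀ = matsFreq β m := rfl
    have hmem : ∀ n : ℤ, p₀ ∈ I n ↔ m = n := fun n => mem_Ioc_iff_ceil_eq hβ p₀ n
    by_cases hmS : m ∈ S
    · rw [Finset.sum_eq_single_of_mem m hmS]
      · rw [Set.indicator_of_mem ((hmem m).mpr rfl), hω]
      · intro n _ hn
        rw [Set.indicator_of_notMem]
        intro h
        exact hn ((hmem n).mp h).symm
    · rw [hω, hf m hmS]
      symm
      apply Finset.sum_eq_zero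
      intro n hn
      rw [Set.indicator_of_notMem]
      intro h
      exact hmS (((hmem n).mp h) ▸ hn)
  rw [hpt, integral_finsetSum]
  · rw [Finset.mul_sum]
    congr 1
    funext n
    rw [integral_indicator_const _ measurableSet_Ioc, Measure.real, Real.volume_Ioc,
      ENNReal.toReal_ofReal (by
        rw [sub_nonneg]; apply div_le_div_of_nonneg_right _ hβ.le; nlinarith [Real.pi_pos]),
      Complex.real_smul]
    congr 1
    push_cast
    ring
  · intro n _
    exact (integrable_indicator_iff measurableSet_Ioc).mpr
      ((integrableOn_const_iff).mpr (Or.inr (by rw [Real.volume_Ioc]; exact ENNReal.ofReal_lt_top)))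

/-! ### Matsubara frequencies: shifts and counting -/

/-- `ω_{n+1} = ω_n + 2π/β`. [cite: Salmhofer1998, §5.5 (p.20 L92–98)] -/
theorem matsFreq_add_one (β : ℝ) (n : ℤ) :
    matsFreq β (n + 1) = matsFreq β n + 2 * Real.pi / β := by
  unfold matsFreq; push_cast; ring

/-- `ω_n - j·(2π/β) = ω_{n-j}` (the shifted arguments of `Δ^q_{2π/β}`). [cite: Salmhofer1998, §5.5 (p.20 L96–98)] -/
theorem matsFreq_sub_int (β : ℝ) (n j : ℤ) :
    matsFreq β n - j * (2 * Real.pi / β) = matsFreq β (n - j) := by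
  unfold matsFreq; push_cast; ring

/-- `e^{ix₀·2π/β} e^{ix₀ω_n} = e^{ix₀ω_{n+1}}`. [cite: Salmhofer1998, §5.5 (5.25′) (p.20 L92–98)] -/
theorem exp_shift_mul_exp_matsFreq (β x₀ : ℝ) (n : ℤ) :
    Complex.exp (Complex.I * ((x₀ * (2 * Real.pi / β) : ℝ) : ℂ)) *
        Complex.exp (Complex.I * ((x₀ * matsFreq β n : ℝ) : ℂ)) =
      Complex.exp (Complex.I * ((x₀ * matsFreq β (n + 1) : ℝ) : ℂ)) := by
  rw [← Complex.exp_add, matsFreq_add_one]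
  congr 1
  push_cast
  ring

/-- **Matsubara counting**: for `β > 0`, `ε ≥ 0` the set `{n ∈ ℤ : |ω_n| ≤ ε}` is finite, with at most
`2βε/π` elements (if it is nonempty then `βε/π ≥ 1`, and `|2n+1| ≤ βε/π` confines `n` to an interval;
cf. "`M_β = β⁻¹|{n : |2n+1| ≤ βε_t/π}| ≤ (2/π)ε_t`"). [cite: Salmhofer1998, Lemma 4 proof (5.19′) (p.20 L19–22)] -/
theorem exists_matsubara_support {β : ℝ} (hβ : 0 < β) {ε : ℝ} (hε : 0 ≤ ε) :
    ∃ S : Finset ℤ, (∀ n : ℤ, n ∈ S ↔ |matsFreq β n| ≤ ε) ∧ (S.card : ℝ) ≤ 2 * β * ε / Real.pi := by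
  classical
  have hπ := Real.pi_pos
  set R : ℝ := β * ε / Real.pi with hR
  have hR0 : 0 ≤ R := by positivity
  -- all admissible `n` lie in `[-N, N]`, `N = ⌈R⌉₊`
  set N : ℕ := ⌈R⌉₊ with hN
  have hkey : ∀ n : ℤ, |matsFreq β n| ≤ ε ↔ |(2 * n + 1 : ℝ)| ≤ R := by
    intro n
    rw [abs_matsFreq hβ, hR, le_div_iff₀ hπ]
    constructor
    · intro h
      have := mul_le_mul_of_nonneg_left h hβ.le
      calc |(2 * n + 1 : ℝ)| * Real.pi = β * (Real.pi / β * |(2 * n + 1 : ℝ)|) := by field_simp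
        _ ≤ β * ε := this
    · intro h
      rw [← mul_le_mul_iff_right₀ hβ]
      calc β * (Real.pi / β * |(2 * n + 1 : ℝ)|) = |(2 * n + 1 : ℝ)| * Real.pi := by field_simp
        _ ≤ β * ε := h
  set S : Finset ℤ := (Finset.Icc (-(N : ℤ)) N).filter fun n => |matsFreq β n| ≤ ε with hS
  have hmem : ∀ n : ℤ, n ∈ S ↔ |matsFreq β n| ≤ ε := by
    intro n
    rw [hS, Finset.mem_filter, Finset.mem_Icc]
    constructor
    · exact fun h => h.2
    · intro h
      refine ⟨?_, h⟩
      have h2 := (hkey n).mp h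
      have hRN : R ≤ N := Nat.le_ceil R
      have h2' : |(2 * n + 1 : ℤ)| ≤ (N : ℤ) := by
        have : ((|2 * n + 1| : ℤ) : ℝ) ≤ (N : ℝ) := by push_cast; exact h2.trans hRN
        exact_mod_cast this
      have h3 := abs_le.mp h2'
      constructor <;> omega
  refine ⟨S, hmem, ?_⟩
  rcases S.eq_empty_or_nonempty with hSe | hSne
  · rw [hSe, Finset.card_empty]; simp only [Nat.cast_zero]; positivity
  · have hall : ∀ n ∈ S, |(2 * n + 1 : ℝ)| ≤ R := fun n hn => (hkey n).mp ((hmem n).mp hn)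
    have hcard := card_le_of_abs_two_mul_add_one_le S hSne hall
    -- nonempty ⇒ `R ≥ 1`
    obtain ⟨n₀, hn₀⟩ := hSne
    have hR1 : 1 ≤ R := by
      have h := hall n₀ hn₀
      have h1 : (1 : ℝ) ≤ |(2 * n₀ + 1 : ℝ)| := by
        rw [show (2 * (n₀ : ℝ) + 1) = ((2 * n₀ + 1 : ℤ) : ℝ) by push_cast; ring, ← Int.cast_abs,
          ← Int.cast_one, Int.cast_le]
        exact Int.one_le_abs (by omega)
      linarith
    calc (S.card : ℝ) ≤ R + 1 := hcard
      _ ≤ 2 * R := by linarith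
      _ = 2 * β * ε / Real.pi := by rw [hR]; ring

/-- The three shifts `S ∪ (S+1) ∪ (S+2)` of a finite set of integers have at most `3|S|` elements.
[cite: Salmhofer1998, §5.5 (p.20 L96–98)] -/
theorem card_union_shifts_le (S : Finset ℤ) :
    ((S ∪ S.image (fun n => n + 1) ∪ S.image (fun n => n + 2)).card : ℝ) ≤ 3 * S.card := by
  classical
  have h1 := Finset.card_union_le (S ∪ S.image (fun n => n + 1)) (S.image (fun n => n + 2))
  have h2 := Finset.card_union_le S (S.image (fun n => n + 1))
  have h3 : (S.image (fun n => n + 1)).card ≤ S.card := Finset.card_image_le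
  have h4 : (S.image (fun n => n + 2)).card ≤ S.card := Finset.card_image_le
  have : (S ∪ S.image (fun n => n + 1) ∪ S.image (fun n => n + 2)).card ≤ 3 * S.card := by omega
  exact_mod_cast this

/-! ### Summation by parts -/

/-- Extending a sum by zero terms: if `c` vanishes off `S ⊆ T` then `Σ_S g·c = Σ_T g·c`.
[cite: Salmhofer1998, §5.5 (p.20 L92–98)] -/
theorem sum_mul_eq_sum_superset {S T : Finset ℤ} (hST : S ⊆ T) {c : ℤ → ℂ}
    (hc : ∀ n, n ∉ S → c n = 0) (g : ℤ → ℂ) :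
    ∑ n ∈ S, g n * c n = ∑ n ∈ T, g n * c n := by
  apply Finset.sum_subset hST
  intro n _ hn
  rw [hc n hn, mul_zero]

/-- **Summation by parts, twice** ((5.25′) with `q = 2`): if `E·e_n = e_{n+1}` for all `n` (for
`e_n = e^{ix₀ω_n}`, `E = e^{2πix₀/β}`) and `c` vanishes off the finite set `S`, then
`(1 - E)² Σ_{n∈S} e_n c_n = Σ_{n ∈ S∪(S+1)∪(S+2)} e_n (c_n - 2c_{n-1} + c_{n-2})`.
[cite: Salmhofer1998, Lemma 5 proof (5.25′) (p.20 L92–98)] -/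
theorem sq_one_sub_mul_sum_eq {e c : ℤ → ℂ} {E : ℂ} (hshift : ∀ n : ℤ, E * e n = e (n + 1))
    {S : Finset ℤ} (hc : ∀ n, n ∉ S → c n = 0) :
    (1 - E) ^ 2 * ∑ n ∈ S, e n * c n =
      ∑ n ∈ (S ∪ S.image (fun n => n + 1) ∪ S.image (fun n => n + 2)),
        e n * (c n - 2 * c (n - 1) + c (n - 2)) := by
  classical
  set T : Finset ℤ := S ∪ S.image (fun n => n + 1) ∪ S.image (fun n => n + 2) with hT
  -- `E Σ e_n c_n = Σ_{S+1} e_n c_{n-1}` and `E² Σ e_n c_n = Σ_{S+2} e_n c_{n-2}`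
  have h1 : E * ∑ n ∈ S, e n * c n = ∑ n ∈ S.image (fun n => n + 1), e n * c (n - 1) := by
    rw [Finset.sum_image (by intro x _ y _ h; simpa using h), Finset.mul_sum]
    refine Finset.sum_congr rfl fun n _ => ?_
    rw [← mul_assoc, hshift n, add_sub_cancel_right]
  have h2 : E ^ 2 * ∑ n ∈ S, e n * c n = ∑ n ∈ S.image (fun n => n + 2), e n * c (n - 2) := by
    rw [Finset.sum_image (by intro x _ y _ h; simpa using h), Finset.mul_sum]
    refine Finset.sum_congr rfl fun n _ => ?_
    have : E ^ 2 * e n = e (n + 2) := by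
      rw [sq, mul_assoc, hshift n, hshift (n + 1)]; ring_nf
    rw [← mul_assoc, this, add_sub_cancel_right]
  -- extend all sums to `T`
  have hS0 : ∑ n ∈ S, e n * c n = ∑ n ∈ T, e n * c n :=
    sum_mul_eq_sum_superset (by rw [hT]; exact Finset.subset_union_left.trans Finset.subset_union_left)
      hc e
  have hS1 : ∑ n ∈ S.image (fun n => n + 1), e n * c (n - 1) = ∑ n ∈ T, e n * c (n - 1) := by
    refine sum_mul_eq_sum_superset (c := fun n => c (n - 1))
      (by rw [hT]; exact Finset.subset_union_right.trans Finset.subset_union_left) ?_ e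
    intro n hn
    apply hc
    intro h
    exact hn (Finset.mem_image.mpr ⟨n - 1, h, by ring⟩)
  have hS2 : ∑ n ∈ S.image (fun n => n + 2), e n * c (n - 2) = ∑ n ∈ T, e n * c (n - 2) := by
    refine sum_mul_eq_sum_superset (c := fun n => c (n - 2))
      (by rw [hT]; exact Finset.subset_union_right) ?_ e
    intro n hn
    apply hc
    intro h
    exact hn (Finset.mem_image.mpr ⟨n - 2, h, by ring⟩)
  have hexp : (1 - E) ^ 2 * ∑ n ∈ S, e n * c n =
      ∑ n ∈ S, e n * c n - 2 * (E * ∑ n ∈ S, e n * c n) + E ^ 2 * ∑ n ∈ S, e n * c n := by ring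
  rw [hexp, h1, h2, hS0, hS1, hS2, Finset.mul_sum, ← Finset.sum_sub_distrib, ← Finset.sum_add_distrib]
  refine Finset.sum_congr rfl fun n _ => ?_
  ring

/-- A finite exponential sum is bounded by the sum of the moduli of its coefficients (`|e^{ix₀ω_n}| = 1`).
[cite: Salmhofer1998, Lemma 5 proof (p.20 L84–90)] -/
theorem norm_sum_mul_le {e : ℤ → ℂ} (he : ∀ n, ‖e n‖ ≤ 1) (F : ℤ → ℂ) (T : Finset ℤ) :
    ‖∑ n ∈ T, e n * F n‖ ≤ ∑ n ∈ T, ‖F n‖ := by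
  refine (norm_sum_le _ _).trans (Finset.sum_le_sum fun n _ => ?_)
  rw [norm_mul]
  calc ‖e n‖ * ‖F n‖ ≤ 1 * ‖F n‖ := by gcongr; exact he n
    _ = ‖F n‖ := one_mul _

/-! ### The lower bound on `|1 - e^{iθ}|` -/

/-- `|1 - e^{iθ}| ≥ (2/π)|θ|` for `|θ| ≤ π` (`|1 - e^{iθ}| = 2|sin(θ/2)|` and Jordan's inequality; for
`θ = 2πx₀/β`, `|x₀| ≤ β/2`, this is `≥ 4|x₀|/β`). [cite: Salmhofer1998, Lemma 5 proof (p.20 L100–103)] -/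
theorem two_div_pi_mul_abs_le_norm_one_sub_exp {θ : ℝ} (hθ : |θ| ≤ Real.pi) :
    2 / Real.pi * |θ| ≤ ‖1 - Complex.exp (Complex.I * (θ : ℂ))‖ := by
  have hπ := Real.pi_pos
  rw [norm_sub_rev, Complex.norm_exp_I_mul_ofReal_sub_one, Real.norm_eq_abs, abs_mul,
    abs_of_pos (by norm_num : (0 : ℝ) < 2)]
  -- Jordan's inequality for `|θ/2| ≤ π/2`
  have hhalf : |θ / 2| ≤ Real.pi / 2 := by rw [abs_div, abs_two]; linarith
  have key : 2 / Real.pi * |θ / 2| ≤ |Real.sin (θ / 2)| := by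
    rcases le_or_gt 0 θ with h0 | h0
    · have h1 : 0 ≤ θ / 2 := by linarith
      rw [abs_of_nonneg h1] at hhalf ⊢
      have := Real.mul_le_sin h1 hhalf
      exact this.trans (le_abs_self _)
    · have h1 : θ / 2 < 0 := by linarith
      rw [abs_of_neg h1] at hhalf ⊢
      have := Real.mul_le_sin (by linarith : 0 ≤ -(θ / 2)) hhalf
      rw [Real.sin_neg] at this
      exact this.trans (neg_le_abs _)
  rw [abs_div, abs_two] at key
  have : 2 / Real.pi * |θ| = 2 * (2 / Real.pi * (|θ| / 2)) := by ring
  rw [this]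
  gcongr

/-- For `|x₀| ≤ β/2`: `|1 - e^{2πix₀/β}| ≥ 4|x₀|/β`. [cite: Salmhofer1998, Lemma 5 proof (p.20 L100–103)] -/
theorem four_mul_abs_div_le_norm_one_sub_exp {β : ℝ} (hβ : 0 < β) {x₀ : ℝ} (hx : |x₀| ≤ β / 2) :
    4 * |x₀| / β ≤ ‖1 - Complex.exp (Complex.I * ((x₀ * (2 * Real.pi / β) : ℝ) : ℂ))‖ := by
  have hπ := Real.pi_pos
  have hθ : |x₀ * (2 * Real.pi / β)| ≤ Real.pi := by
    rw [abs_mul, abs_of_pos (by positivity : 0 < 2 * Real.pi / β)]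
    calc |x₀| * (2 * Real.pi / β) ≤ β / 2 * (2 * Real.pi / β) := by gcongr
      _ = Real.pi := by field_simp
  refine le_trans (le_of_eq ?_) (two_div_pi_mul_abs_le_norm_one_sub_exp hθ)
  rw [abs_mul, abs_of_pos (by positivity : 0 < 2 * Real.pi / β)]
  field_simp
  ring

end Salmhofer1998

end Literature.MathematicalPhysics.QuantumLattice.FermiRG
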